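import Literature.NumberTheory.GaloisRepresentations.LubinTateCharacter
import HarnessLib

/-!
# The Lubin–Tate character `χ_π : Γ_F →ₜ* 𝒪_Fˣ` (the tower and the limit)

Step P4 of the Lubin–Tate programme (`LubinTate.lean`, `LubinTatePoints.lean`, `LubinTateField.lean`,
`LubinTateTorsion.lean`, `LubinTateCharacter.lean`).  For a non-archimedean local field `F`, a
uniformizer `π` and `f = πX + X^q`, the file `LubinTateCharacter.lean` constructs the level-`(n+1)`
characters `ltAbsChar hπ n : Γ_F →* (𝒪_F/π^{n+1})ˣ` through the action of `Γ_F` on the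
`π^{n+1}`-division points `[b]_f λ_{n+1}` of `K_π^{n+1} = F(λ_{n+1})`.  Here we pass to the limit
(Cassels–Fröhlich VI §3.4 Thm. 3 (b), §3.6 Prop. 6; Lubin–Tate 1965 Thm. 2 and Cor.), **fully
proved**:

* **The tower** `ltField_le_succ : K_π^{n+1} ≤ K_π^{n+2}` (`λ_{n+1}` is a root of `f^{(n+2)}`, all of
  whose roots lie in the splitting field `K_π^{n+2}`), the isometric inclusions of valuation rings
  `inclUnitBall`, `inclPt`, and **`ι([a]_f x) = [a]_f (ι x)`** (`inclUnitBall_ltSMul`, `inclPt_ltAct`: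
  evaluating the series `[a]_f` in `𝒪_{K_π^{n+1}}` or in `𝒪_{K_π^{n+2}}` gives the same point).
* **Compatibility** `unitsMap_factor_ltAbsChar_succ`: the level-`(n+2)` character reduces modulo
  `π^{n+1}` to the level-`(n+1)` character (read off `λ_{n+1} = [c]_f λ_{n+2}`).
* **The limit** `lubinTateChar hπ σ ∈ 𝒪_Fˣ`: the unique unit congruent to the level units
  `ltAbsUnit hπ n σ` modulo `π^{n+1}` for every `n` (`𝒪_F` is `𝓂`-adically complete and separated,
  Mathlib's `IsAdicComplete 𝓂[F] 𝒪[F]`); it is multiplicative (`lubinTateCharHom`), it reduces to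
  every `ltAbsChar hπ n` (`unitsModPow_lubinTateChar`), and it has **the defining property**
  `absGal_smul_ltAct_lubinTateChar`: `σ • [b]_f λ_{n+1} = [χ_π(σ) b]_f λ_{n+1}` in `F̄` for all
  `σ ∈ Γ_F`, `n`, `b ∈ 𝒪_F` — `Γ_F` acts on every `π`-power division point through `[χ_π(σ)]_f`;
  `lubinTateChar_eq_one_iff`: `χ_π(σ) = 1` iff `σ` fixes every `K_π^{n+1}`.
* **Continuity** `continuous_lubinTateCharHom` (it is `≡ 1 (mod π^{n+1})` on the open subgroup
  `ker (ltAbsChar hπ n) ⊇ Gal(F̄/K_π^{n+1})`), whence the continuous homomorphism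
  `lubinTateCharacter hπ : Γ_F →ₜ* 𝒪_Fˣ` — **the Lubin–Tate character** (for `F = ℚ_p`, `π = p`,
  `f = (1+X)^p - 1` this is the cyclotomic character).

What is NOT here: surjectivity of `χ_π` onto `𝒪_Fˣ` (each `ltAbsChar hπ n` is onto,
`ltAbsChar_surjective`; the limit statement needs the compactness of `Γ_F` and is left to the user
who needs it); the reciprocity formula `χ_π(Art_F(u)) = u⁻¹` on `𝒪_Fˣ` (Lubin–Tate 1965 Thm. 3;
Cassels–Fröhlich VI §3.7), i.e. the comparison with the tree's local Artin maps `IsLocalArtinMap`;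
the `p`-adic Hodge theory of `χ_π`.

## References

* J.-P. Serre, *Local class field theory*, Ch. VI in Cassels–Fröhlich, *Algebraic Number Theory*
  (1967), §3.4 Thm. 3 (b) ("an isomorphism of `U_K` onto `G(K_π/K)`"), §3.6 Prop. 6 and its proof,
  §3.7.  [CasselsFrohlichANT1967]
* J. Lubin, J. Tate, *Formal complex multiplication in local fields*, Ann. of Math. 81 (1965),
  Thm. 2 and its Corollary, Thm. 3.  [LubinTate1965]
* J.-P. Serre, *Local Fields* (1979), Ch. II §2 (uniqueness of the extension of the absolute value
  to a finite extension; the spectral norm).  [SerreLocalFields1979]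

## Mathlib reuse

`Polynomial.Splits.image_rootSet`, `Polynomial.IsSplittingField.splits`, `minpoly.algHom_eq`,
`IntermediateField.inclusion`, `MvPowerSeries.comp_aeval`, `IsPrecomplete.prec`,
`IsHausdorff.eq_iff_smodEq` (with the instance `IsAdicComplete 𝓂[K] 𝒪[K]` of
`Mathlib/NumberTheory/LocalField/Basic.lean`), `Ideal.Quotient.factor`, `AlgEquiv.restrictNormalHom_apply`,
`IntermediateField.fixingSubgroup_isOpen`, `continuous_of_continuousAt_one`, `Units.continuous_iff`,
`ContinuousMonoidHom`; from the tree: `LubinTateCharacter.lean`, `LubinTateTorsion.lean`,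
`LubinTatePoints.lean`, `LubinTateField.lean`, `AbsGaloisGroup.lean` (`Field.absoluteGaloisGroup.toAlgEquiv`, `smul_def`).
-/

noncomputable section

open Filter Topology Polynomial

namespace Literature.NumberTheory.GaloisRepresentations

section Concrete

open ValuativeRel GaloisRepresentations.IsNonarchimedeanLocalField LubinTate

variable {F : Type*} [Field F] [ValuativeRel F] [TopologicalSpace F] [IsNonarchimedeanLocalField F]

section Normed

-- The normed-field instances on `F` and on the finite subextensions of `F̄` are those declared
-- (as local instances) in `LubinTateTorsion.lean`; they are re-activated here verbatim so that the
-- instances and definitions built there and in `LubinTateCharacter.lean` apply.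
attribute [local instance] instUniformSpace_literature rk1 nF nE ltCharIsUniformAddGroup

variable {π : 𝒪[F]} (hπ : (valuation F).IsUniformizer (π : F))

/-! ### The tower `K_π^{n+1} ⊆ K_π^{n+2}` and the points of `𝔪` along it -/

/-- `aeval x f^{(a+b)} = aeval (aeval x f^{(b)}) f^{(a)}` for the `F`-polynomials `f^{(m)}`. [folklore] -/
theorem aeval_map_ltPolyIter_add {B : Type*} [CommRing B] [Algebra F B] (x : B) (a b : ℕ) :
    aeval x ((ltPolyIter F π (a + b)).map (algebraMap 𝒪[F] F)) =
      aeval (aeval x ((ltPolyIter F π b).map (algebraMap 𝒪[F] F)))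
        ((ltPolyIter F π a).map (algebraMap 𝒪[F] F)) := by
  rw [ltPolyIter_add, Polynomial.map_comp, Polynomial.aeval_comp]

/-- `f^{(a)}(0) = 0`. [folklore] -/
theorem aeval_zero_map_ltPolyIter {B : Type*} [CommRing B] [Algebra F B] (a : ℕ) :
    aeval (0 : B) ((ltPolyIter F π a).map (algebraMap 𝒪[F] F)) = 0 := by
  rw [← Polynomial.coeff_zero_eq_aeval_zero', Polynomial.coeff_map, coeff_zero_ltPolyIter, map_zero,
    map_zero]

/-- A root of `f^{(b)}` is a root of `f^{(m)}` for every `m ≥ b` (`f^{(m)} = f^{(m-b)} ∘ f^{(b)}` and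
`f^{(k)}(0) = 0`). [folklore] -/
theorem aeval_map_ltPolyIter_eq_zero_of_le {B : Type*} [CommRing B] [Algebra F B] {x : B} {b m : ℕ}
    (hx : aeval x ((ltPolyIter F π b).map (algebraMap 𝒪[F] F)) = 0) (hm : b ≤ m) :
    aeval x ((ltPolyIter F π m).map (algebraMap 𝒪[F] F)) = 0 := by
  obtain ⟨a, rfl⟩ := Nat.exists_eq_add_of_le hm
  rw [add_comm, aeval_map_ltPolyIter_add, hx, aeval_zero_map_ltPolyIter]

/-- `λ_{n+1}` is a root of `f^{(n+1)} = f^{(n)} φ_{n+1}`. [cite: CasselsFrohlichANT1967, Ch. VI §3.6] -/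
theorem aeval_ltRoot_map_ltPolyIter_succ (n : ℕ) :
    aeval (ltRoot π n) ((ltPolyIter F π (n + 1)).map (algebraMap 𝒪[F] F)) = 0 := by
  rw [ltPolyIter_succ_eq_mul, Polynomial.map_mul, aeval_mul, aeval_ltRoot, mul_zero]

include hπ in
/-- The generator `λ_{n+1} ∈ K_π^{n+1}` is a root of `f^{(n+1)}` (in `K_π^{n+1}`). [cite: CasselsFrohlichANT1967, Ch. VI §3.6] -/
theorem aeval_gen_map_ltPolyIter_succ (n : ℕ) :
    aeval (IntermediateField.AdjoinSimple.gen F (ltRoot π n) : ltField π n)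
      ((ltPolyIter F π (n + 1)).map (algebraMap 𝒪[F] F)) = 0 := by
  rw [ltPolyIter_succ_eq_mul, Polynomial.map_mul, aeval_mul, ← minpoly_ltRoot π hπ n,
    IntermediateField.aeval_gen_minpoly, mul_zero]

include hπ in
/-- **All roots of `f^{(m+1)}` in `F̄` lie in `K_π^{m+1}`** (it is a splitting field, accepted
`isSplittingField_ltField`, and the roots of a split polynomial in a bigger field are the images of
its roots, Mathlib's `Polynomial.Splits.image_rootSet`). [cite: CasselsFrohlichANT1967, Ch. VI §3.6 Prop. 6 (a)] -/
theorem mem_ltField_of_aeval_map_ltPolyIter_eq_zero {m : ℕ} {x : AlgebraicClosure F}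
    (hx : aeval x ((ltPolyIter F π (m + 1)).map (algebraMap 𝒪[F] F)) = 0) : x ∈ ltField π m := by
  haveI := isSplittingField_ltField hπ m
  have hsplit := Polynomial.IsSplittingField.splits (ltField π m)
    ((ltPolyIter F π (m + 1)).map (algebraMap 𝒪[F] F))
  have hP0 : (ltPolyIter F π (m + 1)).map (algebraMap 𝒪[F] F) ≠ 0 :=
    ((monic_ltPolyIter π (m + 1)).1.map _).ne_zero
  have hmem : x ∈ ((ltPolyIter F π (m + 1)).map (algebraMap 𝒪[F] F)).rootSet (AlgebraicClosure F) :=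
    Polynomial.mem_rootSet.mpr ⟨hP0, hx⟩
  rw [← hsplit.image_rootSet (IntermediateField.val (ltField π m))] at hmem
  obtain ⟨y, -, rfl⟩ := hmem
  exact y.2

include hπ in
/-- **`λ_{n+1} ∈ K_π^{n+2}`.** [cite: CasselsFrohlichANT1967, Ch. VI §3.6] -/
theorem ltRoot_mem_ltField_succ (n : ℕ) : ltRoot π n ∈ ltField π (n + 1) :=
  mem_ltField_of_aeval_map_ltPolyIter_eq_zero hπ
    (aeval_map_ltPolyIter_eq_zero_of_le (aeval_ltRoot_map_ltPolyIter_succ (π := π) n) (Nat.le_succ _))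

include hπ in
/-- **The Lubin–Tate tower**: `K_π^{n+1} ≤ K_π^{n+2}`. [cite: CasselsFrohlichANT1967, Ch. VI §3.6] -/
theorem ltField_le_succ (n : ℕ) : ltField π n ≤ ltField π (n + 1) :=
  IntermediateField.adjoin_le_iff.mpr (Set.singleton_subset_iff.mpr (ltRoot_mem_ltField_succ hπ n))

include hπ in
/-- The Lubin–Tate fields increase with the level. [cite: CasselsFrohlichANT1967, Ch. VI §3.6] -/
theorem ltField_mono : Monotone (ltField π) :=
  monotone_nat_of_le_succ (ltField_le_succ hπ)

section Inclusion

variable {E₁ E₂ : IntermediateField F (AlgebraicClosure F)} [FiniteDimensional F E₁]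
  [FiniteDimensional F E₂]

omit hπ in
/-- The inclusion of finite subextensions of `F̄` is an isometry for the spectral norms (the
spectral norm of `x` only depends on its minimal polynomial over `F`). [cite: SerreLocalFields1979, Ch. II §2 Cor. 3] -/
theorem norm_inclusion (h : E₁ ≤ E₂) (x : E₁) : ‖IntermediateField.inclusion h x‖ = ‖x‖ := by
  rw [norm_eq_spectralNorm, norm_eq_spectralNorm, spectralNorm, spectralNorm,
    minpoly.algHom_eq (IntermediateField.inclusion h) (IntermediateField.inclusion_injective h) x]

omit hπ in
/-- The inclusion `𝒪_{E₁} → 𝒪_{E₂}` along `E₁ ≤ E₂`, as an algebra map over the discrete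
coefficient ring. [folklore] -/
def inclUnitBall (h : E₁ ≤ E₂) : unitBall E₁ →ₐ[LTCoeff F] unitBall E₂ where
  toFun x := ⟨IntermediateField.inclusion h x, by
    rw [mem_unitBall_iff, norm_inclusion]; exact (mem_unitBall_iff E₁).mp x.2⟩
  map_one' := by ext; simp
  map_mul' x y := by ext; simp
  map_zero' := by ext; simp
  map_add' x y := by ext; simp
  commutes' a := by
    apply Subtype.ext
    change IntermediateField.inclusion h
      ((algebraMap (LTCoeff F) (unitBall E₁) a : unitBall E₁) : E₁) = _
    exact (IntermediateField.inclusion h).commutes ((LTCoeff.of F).symm a : 𝒪[F])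

omit hπ in
/-- `inclUnitBall h x` is `x` (unfolding). [folklore] -/
theorem coe_inclUnitBall (h : E₁ ≤ E₂) (x : unitBall E₁) :
    ((inclUnitBall (F := F) h x : unitBall E₂) : E₂) = IntermediateField.inclusion h x := rfl

omit hπ in
/-- The inclusion of valuation rings is continuous (an isometry). [folklore] -/
theorem continuous_inclUnitBall (h : E₁ ≤ E₂) : Continuous (inclUnitBall (F := F) h) := by
  have hiso : Isometry (inclUnitBall (F := F) h) := by
    refine Isometry.of_dist_eq fun x y => ?_
    change dist (IntermediateField.inclusion h x : E₂) (IntermediateField.inclusion h y) =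
      dist (x : E₁) y
    rw [dist_eq_norm, dist_eq_norm, ← _root_.map_sub, norm_inclusion]
  exact hiso.continuous

omit hπ in
/-- A point of `𝔪_{E₁}` as a point of `𝔪_{E₂}`. [folklore] -/
def inclPt (h : E₁ ≤ E₂) (x : (maxNilIdeal F E₁).toIdeal) : (maxNilIdeal F E₂).toIdeal :=
  ⟨inclUnitBall h x, by
    change ‖(IntermediateField.inclusion h ((x : unitBall E₁) : E₁) : E₂)‖ < 1
    rw [norm_inclusion]; exact x.2⟩

omit hπ in
/-- `inclPt h x` is `x` as an element of `F̄` (unfolding). [folklore] -/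
theorem coe_inclPt (h : E₁ ≤ E₂) (x : (maxNilIdeal F E₁).toIdeal) :
    ((((inclPt (F := F) h x : (maxNilIdeal F E₂).toIdeal) : unitBall E₂) : E₂) : AlgebraicClosure F) =
      (((x : unitBall E₁) : E₁) : AlgebraicClosure F) := rfl

/-- **The inclusion commutes with `[a]_f`**: evaluating the series `[a]_f ∈ 𝒪_F⟦X⟧` in `𝒪_{E₁}` or in
`𝒪_{E₂} ⊇ 𝒪_{E₁}` gives the same point (the inclusion is continuous; Mathlib's
`MvPowerSeries.comp_aeval`). [folklore] -/
theorem inclUnitBall_ltSMul (h : E₁ ≤ E₂) {hA : IsLTRing (LTCoeff.of F π) (residueFieldCard F)}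
    (a : LTCoeff F) (x : (maxNilIdeal F E₁).toIdeal) :
    inclUnitBall h (ltSMul (maxNilIdeal F E₁) hA (isLTSeries_LTCoeff π) a x) =
      ltSMul (maxNilIdeal F E₂) hA (isLTSeries_LTCoeff π) a (inclPt h x) := by
  unfold ltSMul evalPt₁
  rw [coe_evalPt, coe_evalPt, ← AlgHom.comp_apply,
    MvPowerSeries.comp_aeval _ (continuous_inclUnitBall h)]
  rfl

end Inclusion

/-- In the tower, `[a]_f` computed at level `n+1` and at level `n+2` agree:
`ι([a] x) = [a] (ι x)` for a point `x` of `𝔪_{K_π^{n+1}}`. [folklore] -/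
theorem inclPt_ltAct (n : ℕ) (a : 𝒪[F]) (x : (maxNilIdeal F (ltField π n)).toIdeal) :
    inclPt (ltField_le_succ hπ n) (ltAct hπ n a x) =
      ltAct hπ (n + 1) a (inclPt (ltField_le_succ hπ n) x) :=
  Subtype.ext (inclUnitBall_ltSMul (ltField_le_succ hπ n) (LTCoeff.of F a) x)

/-- **`λ_{n+1}` is a `π^{n+2}`-division point of level `n+2`**: in `K_π^{n+2}`, `λ_{n+1} = [c] λ_{n+2}` for
some `c ∈ 𝒪_F` (all roots of `f^{(n+2)}` in `K_π^{n+2}` are of this form, accepted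
`card_roots_ltPolyIter`). [cite: CasselsFrohlichANT1967, Ch. VI §3.6 Prop. 6 (a)] -/
theorem exists_inclPt_genPt_eq (n : ℕ) :
    ∃ c : 𝒪[F], inclPt (ltField_le_succ hπ n) (genPt hπ n) = ltAct hπ (n + 1) c (genPt hπ (n + 1)) := by
  classical
  obtain ⟨-, -, hroots⟩ := card_roots_ltPolyIter hπ (n + 1)
  have hP0 : (((ltPolyIter F π (n + 1 + 1)).map (algebraMap 𝒪[F] F)).map
      (algebraMap F (ltField π (n + 1)))) ≠ 0 :=
    (((monic_ltPolyIter π (n + 1 + 1)).1.map _).map _).ne_zero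
  obtain ⟨c, hc⟩ := hroots (IntermediateField.inclusion (ltField_le_succ hπ n)
    (IntermediateField.AdjoinSimple.gen F (ltRoot π n))) (by
    rw [Polynomial.mem_roots hP0, Polynomial.IsRoot.def, Polynomial.eval_map,
      ← Polynomial.aeval_def, Polynomial.aeval_algHom_apply,
      aeval_map_ltPolyIter_eq_zero_of_le (aeval_gen_map_ltPolyIter_succ hπ n) (Nat.le_succ _),
      map_zero])
  exact ⟨c, Subtype.ext (Subtype.ext hc)⟩

/-- Points of `𝔪_E` with the same image in `F̄` are equal. [folklore] -/
theorem pt_ext {E : IntermediateField F (AlgebraicClosure F)} [FiniteDimensional F E]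
    {x y : (maxNilIdeal F E).toIdeal}
    (h : (((x : unitBall E) : E) : AlgebraicClosure F) = (((y : unitBall E) : E) : AlgebraicClosure F)) :
    x = y :=
  Subtype.ext (Subtype.ext (Subtype.ext h))

/-- **Compatibility of the Lubin–Tate characters in the tower**: the level-`(n+2)` character of
`σ ∈ Γ_F` reduces modulo `π^{n+1}` to the level-`(n+1)` character (both are read off the action of
`σ` on `λ_{n+1} = [c] λ_{n+2} ∈ K_π^{n+2}`). [cite: CasselsFrohlichANT1967, Ch. VI §3.6 Prop. 6 (b)] -/
theorem unitsMap_factor_ltAbsChar_succ (n : ℕ) (σ : Field.absoluteGaloisGroup F) :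
    Units.map (Ideal.Quotient.factor (Ideal.span_singleton_le_span_singleton.mpr
        (pow_dvd_pow π (Nat.le_succ (n + 1))))).toMonoidHom (ltAbsChar hπ (n + 1) σ) =
      ltAbsChar hπ n σ := by
  haveI := isGalois_ltField hπ n
  haveI := isGalois_ltField hπ (n + 1)
  set σ₁ := AlgEquiv.restrictNormalHom (ltField π n) (Field.absoluteGaloisGroup.toAlgEquiv F σ)
    with hσ₁
  set σ₂ := AlgEquiv.restrictNormalHom (ltField π (n + 1))
    (Field.absoluteGaloisGroup.toAlgEquiv F σ) with hσ₂
  set a : 𝒪[F] := (ltGalUnit hπ (n + 1) σ₂ : 𝒪[F]) with ha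
  obtain ⟨c, hc⟩ := exists_inclPt_genPt_eq hπ n
  -- the action of `σ` on `λ_{n+1}`, read in `K_π^{n+2}`
  have key : mapPt σ₁ (genPt hπ n) = ltAct hπ n a (genPt hπ n) := by
    apply pt_ext
    rw [coe_mapPt, ← coe_inclPt (ltField_le_succ hπ n) (ltAct hπ n a (genPt hπ n)), inclPt_ltAct, hc,
      ← absGal_smul_ltAct_of_coe_ltAbsChar_eq hπ (σ := σ) (a := a) rfl c]
    change ((σ₁ (IntermediateField.AdjoinSimple.gen F (ltRoot π n)) : ltField π n) :
        AlgebraicClosure F) = σ • _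
    rw [hσ₁, AlgEquiv.restrictNormalHom_apply, Field.absoluteGaloisGroup.smul_def]
    congr 1
    change (ltRoot π n : AlgebraicClosure F) =
      (((ltAct hπ (n + 1) c (genPt hπ (n + 1)) : unitBall (ltField π (n + 1))) :
        ltField π (n + 1)) : AlgebraicClosure F)
    rw [← hc, coe_inclPt]
    rfl
  have hdvd : π ^ (n + 1) ∣ a - ltGalUnit hπ n σ₁ := dvd_sub_ltGalUnit_of_mapPt_eq hπ key
  -- both sides are reductions of units
  refine Units.ext ?_
  change Ideal.Quotient.factor _ (Ideal.Quotient.mk _ a) =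
    Ideal.Quotient.mk _ (ltGalUnit hπ n σ₁ : 𝒪[F])
  rw [Ideal.Quotient.factor_mk, Ideal.Quotient.eq, Ideal.mem_span_singleton]
  exact hdvd

/-! ### The limit: the Lubin–Tate character `χ_π : Γ_F →* 𝒪_Fˣ` -/

include hπ in
/-- `𝓂_F = (π)` for a uniformizer `π`. [folklore] -/
theorem maximalIdeal_eq_span_singleton : 𝓂[F] = Ideal.span {π} := by
  refine le_antisymm (fun x hx => Ideal.mem_span_singleton.mpr (dvd_of_mem_maximalIdeal F hπ hx)) ?_
  rw [Ideal.span_singleton_le_iff_mem, mem_maximalIdeal_iff_valuation_lt_one]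
  exact hπ.val_lt_one

include hπ in
/-- `x ∈ 𝓂_F^k ↔ π^k ∣ x`. [folklore] -/
theorem mem_maximalIdeal_pow_iff {k : ℕ} {x : 𝒪[F]} : x ∈ 𝓂[F] ^ k ↔ π ^ k ∣ x := by
  rw [maximalIdeal_eq_span_singleton hπ, Ideal.span_singleton_pow, Ideal.mem_span_singleton]

include hπ in
/-- Membership in the submodule `𝓂^k • ⊤` of the adic-completion API. [folklore] -/
theorem mem_maximalIdeal_pow_smul_top_iff {k : ℕ} {x : 𝒪[F]} :
    x ∈ (𝓂[F] ^ k • ⊤ : Submodule 𝒪[F] 𝒪[F]) ↔ π ^ k ∣ x := by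
  rw [Ideal.smul_eq_mul, Ideal.mul_top, mem_maximalIdeal_pow_iff hπ]

include hπ in
/-- **Limits of compatible units**: a sequence of units `u_n` with `u_{n+1} ≡ u_n (mod π^{n+1})` has a
limit, a unit `w` with `w ≡ u_n (mod π^{n+1})` for all `n` (`𝒪_F` is `𝓂`-adically complete, Mathlib's
`IsAdicComplete 𝓂[F] 𝒪[F]`). [folklore] -/
theorem exists_unit_forall_pow_dvd_sub {u : ℕ → 𝒪[F]ˣ}
    (hu : ∀ n, π ^ (n + 1) ∣ (u (n + 1) : 𝒪[F]) - u n) :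
    ∃ w : 𝒪[F]ˣ, ∀ n, π ^ (n + 1) ∣ (w : 𝒪[F]) - u n := by
  -- telescoping
  have htel : ∀ m n, m ≤ n → π ^ (m + 1) ∣ (u n : 𝒪[F]) - u m := by
    intro m n hmn
    induction n, hmn using Nat.le_induction with
    | base => simp
    | succ k hk ih =>
      have h1 : π ^ (m + 1) ∣ (u (k + 1) : 𝒪[F]) - u k :=
        (pow_dvd_pow π (Nat.succ_le_succ hk)).trans (hu k)
      have h2 := dvd_add h1 ih
      rwa [sub_add_sub_cancel] at h2
  obtain ⟨L, hL⟩ := IsPrecomplete.prec (I := 𝓂[F]) (M := 𝒪[F]) inferInstance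
    (f := fun n => (u n : 𝒪[F])) (fun {m n} hmn => by
      rw [SModEq.sub_mem, mem_maximalIdeal_pow_smul_top_iff hπ, ← dvd_neg, neg_sub]
      exact (pow_dvd_pow π (Nat.le_succ m)).trans (htel m n hmn))
  have hL' : ∀ n, π ^ (n + 1) ∣ L - u n := fun n => by
    have h1 := hL (n + 1)
    rw [SModEq.sub_mem, mem_maximalIdeal_pow_smul_top_iff hπ] at h1
    have h2 := dvd_sub (hu n) h1
    rwa [sub_sub_sub_cancel_left] at h2
  have hunit : IsUnit L := by
    by_contra hL0
    have hmem : L ∈ 𝓂[F] := (IsLocalRing.mem_maximalIdeal L).mpr hL0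
    have h0 : π ∣ L - u 0 := by simpa using hL' 0
    have hu0 : (u 0 : 𝒪[F]) ∈ 𝓂[F] := by
      have e : (u 0 : 𝒪[F]) = L - (L - u 0) := by ring
      have h0' : L - u 0 ∈ 𝓂[F] := by
        rw [maximalIdeal_eq_span_singleton hπ, Ideal.mem_span_singleton]; exact h0
      rw [e]
      exact sub_mem hmem h0'
    exact (IsLocalRing.mem_maximalIdeal _).mp hu0 (u 0).isUnit
  exact ⟨hunit.unit, fun n => by rw [IsUnit.unit_spec]; exact hL' n⟩

include hπ in
/-- An element divisible by every power of `π` is zero (`𝒪_F` is `𝓂`-adically separated). [folklore] -/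
theorem eq_of_forall_pow_dvd_sub {w w' : 𝒪[F]} (h : ∀ n, π ^ (n + 1) ∣ w - w') : w = w' := by
  refine (IsHausdorff.eq_iff_smodEq (I := 𝓂[F])).mpr fun n => ?_
  rw [SModEq.sub_mem, mem_maximalIdeal_pow_smul_top_iff hπ]
  exact (pow_dvd_pow π (Nat.le_succ n)).trans (h n)

/-- The unit of `σ ∈ Γ_F` at level `n+1`: `σ • [b]λ_{n+1} = [u]([b]λ_{n+1})` (`absGal_smul_ltAct`).
[cite: CasselsFrohlichANT1967, Ch. VI §3.6 Prop. 6 (b)] -/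
def ltAbsUnit (n : ℕ) (σ : Field.absoluteGaloisGroup F) : 𝒪[F]ˣ :=
  haveI := isGalois_ltField hπ n
  ltGalUnit hπ n (AlgEquiv.restrictNormalHom (ltField π n) (Field.absoluteGaloisGroup.toAlgEquiv F σ))

/-- `ltAbsChar` is the reduction of `ltAbsUnit` (unfolding). [folklore] -/
theorem ltAbsChar_eq_unitsModPow (n : ℕ) (σ : Field.absoluteGaloisGroup F) :
    ltAbsChar hπ n σ = unitsModPow π n (ltAbsUnit hπ n σ) := rfl

/-- The action formula at level `n+1` with the unit `ltAbsUnit`: `σ • [b]λ_{n+1} = [u_n(σ)]([b]λ_{n+1})`. [cite: CasselsFrohlichANT1967, Ch. VI §3.6 Prop. 6 (b)] -/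
theorem absGal_smul_ltAct_ltAbsUnit (n : ℕ) (σ : Field.absoluteGaloisGroup F) (b : 𝒪[F]) :
    σ • ((((ltAct hπ n b (genPt hπ n) : unitBall (ltField π n)) : ltField π n) : AlgebraicClosure F)) =
      (((ltAct hπ n (ltAbsUnit hπ n σ : 𝒪[F]) (ltAct hπ n b (genPt hπ n)) : unitBall (ltField π n)) :
        ltField π n) : AlgebraicClosure F) :=
  absGal_smul_ltAct hπ n σ b

/-- **The units of `σ` at consecutive levels are congruent**: `u_{n+1}(σ) ≡ u_n(σ) (mod π^{n+1})`. [cite: CasselsFrohlichANT1967, Ch. VI §3.6 Prop. 6 (b)] -/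
theorem pow_dvd_ltAbsUnit_succ_sub (n : ℕ) (σ : Field.absoluteGaloisGroup F) :
    π ^ (n + 1) ∣ (ltAbsUnit hπ (n + 1) σ : 𝒪[F]) - ltAbsUnit hπ n σ := by
  have h := unitsMap_factor_ltAbsChar_succ hπ n σ
  rw [ltAbsChar_eq_unitsModPow, ltAbsChar_eq_unitsModPow] at h
  have h' : unitsModPow π n (ltAbsUnit hπ (n + 1) σ) = unitsModPow π n (ltAbsUnit hπ n σ) := by
    rw [← h]
    exact Units.ext (Ideal.Quotient.factor_mk _ _).symm
  exact (unitsModPow_eq_iff).mp h'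

/-- **The Lubin–Tate character** `χ_π(σ) ∈ 𝒪_Fˣ` of `σ ∈ Γ_F`: the limit of the compatible units
`u_n(σ)`, i.e. the unique unit with `χ_π(σ) ≡ u_n(σ) (mod π^{n+1})` for all `n`, so that
`σ • x = [χ_π(σ)]_f x` for every `π`-power division point `x` (`absGal_smul_ltAct_lubinTateChar`).
Cassels–Fröhlich VI §3.4 Thm. 3 (b) ("`u ↦ [u⁻¹]_f` … an isomorphism of `U_K` onto `G(K_π/K)`",
here in the direction `G → U_K`); Lubin–Tate 1965, Cor. to Thm. 2.
[cite: CasselsFrohlichANT1967, Ch. VI §3.4 Thm. 3 (b)] -/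
def lubinTateChar (σ : Field.absoluteGaloisGroup F) : 𝒪[F]ˣ :=
  Classical.choose (exists_unit_forall_pow_dvd_sub hπ (u := fun n => ltAbsUnit hπ n σ)
    (fun n => pow_dvd_ltAbsUnit_succ_sub hπ n σ))

/-- `χ_π(σ) ≡ u_n(σ) (mod π^{n+1})`. [cite: CasselsFrohlichANT1967, Ch. VI §3.4 Thm. 3 (b)] -/
theorem pow_dvd_lubinTateChar_sub (σ : Field.absoluteGaloisGroup F) (n : ℕ) :
    π ^ (n + 1) ∣ (lubinTateChar hπ σ : 𝒪[F]) - ltAbsUnit hπ n σ :=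
  Classical.choose_spec (exists_unit_forall_pow_dvd_sub hπ (u := fun n => ltAbsUnit hπ n σ)
    (fun n => pow_dvd_ltAbsUnit_succ_sub hπ n σ)) n

/-- **Uniqueness**: a unit congruent to every `u_n(σ)` is `χ_π(σ)`. [folklore] -/
theorem eq_lubinTateChar_of_forall_dvd {σ : Field.absoluteGaloisGroup F} {w : 𝒪[F]ˣ}
    (hw : ∀ n, π ^ (n + 1) ∣ (w : 𝒪[F]) - ltAbsUnit hπ n σ) : w = lubinTateChar hπ σ := by
  refine Units.ext (eq_of_forall_pow_dvd_sub hπ fun n => ?_)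
  have h := dvd_sub (hw n) (pow_dvd_lubinTateChar_sub hπ σ n)
  rwa [sub_sub_sub_cancel_right] at h

/-- `χ_π(σ)` reduces to the level-`(n+1)` character: `χ_π(σ) mod π^{n+1} = ltAbsChar hπ n σ`. [cite: CasselsFrohlichANT1967, Ch. VI §3.6 Prop. 6 (b)] -/
theorem unitsModPow_lubinTateChar (n : ℕ) (σ : Field.absoluteGaloisGroup F) :
    unitsModPow π n (lubinTateChar hπ σ) = ltAbsChar hπ n σ := by
  rw [ltAbsChar_eq_unitsModPow, unitsModPow_eq_iff]
  exact pow_dvd_lubinTateChar_sub hπ σ n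

/-- `χ_π(1) = 1`. [folklore] -/
theorem lubinTateChar_one : lubinTateChar hπ (1 : Field.absoluteGaloisGroup F) = 1 := by
  refine (eq_lubinTateChar_of_forall_dvd hπ fun n => ?_).symm
  have h : unitsModPow π n 1 = unitsModPow π n (ltAbsUnit hπ n 1) := by
    rw [← ltAbsChar_eq_unitsModPow, map_one, map_one]
  exact unitsModPow_eq_iff.mp h

/-- `χ_π(στ) = χ_π(σ) χ_π(τ)`. [cite: CasselsFrohlichANT1967, Ch. VI §3.4 Thm. 3 (b)] -/
theorem lubinTateChar_mul (σ τ : Field.absoluteGaloisGroup F) :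
    lubinTateChar hπ (σ * τ) = lubinTateChar hπ σ * lubinTateChar hπ τ := by
  refine (eq_lubinTateChar_of_forall_dvd hπ fun n => ?_).symm
  have h1 : unitsModPow π n (lubinTateChar hπ σ * lubinTateChar hπ τ) =
      unitsModPow π n (ltAbsUnit hπ n (σ * τ)) := by
    rw [map_mul, unitsModPow_lubinTateChar, unitsModPow_lubinTateChar, ← map_mul,
      ltAbsChar_eq_unitsModPow]
  exact unitsModPow_eq_iff.mp h1

/-- **The Lubin–Tate character as a homomorphism `χ_π : Γ_F →* 𝒪_Fˣ`.**
[cite: CasselsFrohlichANT1967, Ch. VI §3.4 Thm. 3 (b)] -/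
def lubinTateCharHom : Field.absoluteGaloisGroup F →* 𝒪[F]ˣ where
  toFun := lubinTateChar hπ
  map_one' := lubinTateChar_one hπ
  map_mul' := lubinTateChar_mul hπ

/-- Unfolding of `lubinTateCharHom`. [folklore] -/
theorem lubinTateCharHom_apply (σ : Field.absoluteGaloisGroup F) :
    lubinTateCharHom hπ σ = lubinTateChar hπ σ := rfl

/-- **The defining property of `χ_π`**: `σ • [b] λ_{n+1} = [χ_π(σ) b] λ_{n+1}` in `F̄`, for every
`σ ∈ Γ_F`, every level `n` and every `b ∈ 𝒪_F` — `σ` acts on all `π`-power division points of the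
Lubin–Tate group as `[χ_π(σ)]_f`. [cite: CasselsFrohlichANT1967, Ch. VI §3.4 Thm. 3 (b)] -/
theorem absGal_smul_ltAct_lubinTateChar (σ : Field.absoluteGaloisGroup F) (n : ℕ) (b : 𝒪[F]) :
    σ • ((((ltAct hπ n b (genPt hπ n) : unitBall (ltField π n)) : ltField π n) : AlgebraicClosure F)) =
      (((ltAct hπ n ((lubinTateChar hπ σ : 𝒪[F]) * b) (genPt hπ n) : unitBall (ltField π n)) :
        ltField π n) : AlgebraicClosure F) := by
  rw [absGal_smul_ltAct_ltAbsUnit, ← ltAct_mul]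
  congr 3
  refine ltAct_genPt_eq_of_dvd_sub hπ ?_
  rw [← sub_mul]
  exact Dvd.dvd.mul_right ((dvd_sub_comm).mp (pow_dvd_lubinTateChar_sub hπ σ n)) b

/-- In particular `σ • λ_{n+1} = [χ_π(σ)] λ_{n+1}`. [cite: CasselsFrohlichANT1967, Ch. VI §3.4 Thm. 3 (b)] -/
theorem absGal_smul_ltRoot (σ : Field.absoluteGaloisGroup F) (n : ℕ) :
    σ • ltRoot π n =
      (((ltAct hπ n (lubinTateChar hπ σ : 𝒪[F]) (genPt hπ n) : unitBall (ltField π n)) :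
        ltField π n) : AlgebraicClosure F) := by
  have h := absGal_smul_ltAct_lubinTateChar hπ σ n 1
  rw [mul_one, ltAct_one] at h
  exact h

/-- **`χ_π(σ) = 1 ↔ σ` fixes every Lubin–Tate field `K_π^{n+1}`** (pointwise). [cite: CasselsFrohlichANT1967, Ch. VI §3.6 Prop. 6 (b)] -/
theorem lubinTateChar_eq_one_iff (σ : Field.absoluteGaloisGroup F) :
    lubinTateChar hπ σ = 1 ↔ ∀ n, ∀ x ∈ ltField π n, σ • x = x := by
  constructor
  · intro h n x hx
    haveI := isGalois_ltField hπ n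
    have h1 : ltAbsChar hπ n σ = 1 := by rw [← unitsModPow_lubinTateChar, h, map_one]
    rw [ltAbsChar_apply] at h1
    have h2 := ltGalChar_injective hπ n (h1.trans (map_one _).symm)
    have h3 := AlgEquiv.restrictNormalHom_apply (ltField π n)
      (Field.absoluteGaloisGroup.toAlgEquiv F σ) ⟨x, hx⟩
    rw [h2, AlgEquiv.one_apply] at h3
    rw [Field.absoluteGaloisGroup.smul_def]
    exact h3.symm
  · intro h
    refine (eq_lubinTateChar_of_forall_dvd hπ fun n => ?_).symm
    haveI := isGalois_ltField hπ n
    have h1 : AlgEquiv.restrictNormalHom (ltField π n) (Field.absoluteGaloisGroup.toAlgEquiv F σ) = 1 := by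
      ext x
      rw [AlgEquiv.restrictNormalHom_apply, AlgEquiv.one_apply]
      exact h n x x.2
    have h2 : unitsModPow π n 1 = unitsModPow π n (ltAbsUnit hπ n σ) := by
      rw [← ltAbsChar_eq_unitsModPow, ltAbsChar_apply, h1, map_one, map_one]
    exact unitsModPow_eq_iff.mp h2

/-! ### Continuity of `χ_π` -/

/-- The kernel of the level-`(n+1)` character is open in `Γ_F` (it contains the open subgroup
`Gal(F̄/K_π^{n+1})`). [folklore] -/
theorem isOpen_ker_ltAbsChar (n : ℕ) : IsOpen ((ltAbsChar hπ n).ker : Set (Field.absoluteGaloisGroup F)) := by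
  haveI := isGalois_ltField hπ n
  apply Subgroup.isOpen_mono (H₁ := ((ltField π n).fixingSubgroup).comap
    (Field.absoluteGaloisGroup.toAlgEquiv F).toMonoidHom)
  · intro σ hσ
    rw [Subgroup.mem_comap, IntermediateField.mem_fixingSubgroup_iff] at hσ
    rw [MonoidHom.mem_ker, ltAbsChar_apply]
    have h1 : AlgEquiv.restrictNormalHom (ltField π n) (Field.absoluteGaloisGroup.toAlgEquiv F σ) = 1 := by
      ext x
      rw [AlgEquiv.restrictNormalHom_apply, AlgEquiv.one_apply]
      exact hσ x x.2
    rw [h1, map_one]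
  · exact (IntermediateField.fixingSubgroup_isOpen (ltField π n)).preimage continuous_id

/-- `χ_π(σ) ≡ 1 (mod π^{n+1})` on the kernel of the level-`(n+1)` character. [folklore] -/
theorem pow_dvd_lubinTateChar_sub_one {n : ℕ} {σ : Field.absoluteGaloisGroup F}
    (hσ : σ ∈ (ltAbsChar hπ n).ker) : π ^ (n + 1) ∣ (lubinTateChar hπ σ : 𝒪[F]) - 1 := by
  rw [MonoidHom.mem_ker, ← unitsModPow_lubinTateChar, ← map_one (unitsModPow π n),
    unitsModPow_eq_iff] at hσ
  simpa using hσ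

/-- `‖x‖ ≤ ‖π‖^{n+1}` in `F` when `π^{n+1} ∣ x` in `𝒪_F`. [folklore] -/
theorem norm_le_of_pow_dvd {n : ℕ} {x : 𝒪[F]} (h : π ^ (n + 1) ∣ x) :
    ‖(x : F)‖ ≤ ‖(π : F)‖ ^ (n + 1) := by
  obtain ⟨c, rfl⟩ := h
  rw [Subring.coe_mul, SubmonoidClass.coe_pow, norm_mul, norm_pow]
  exact mul_le_of_le_one_right (pow_nonneg (norm_nonneg _) _)
    ((Valued.toNormedField.norm_le_one_iff).mpr c.2)

include hπ in
/-- `‖π‖ < 1`. [folklore] -/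
theorem norm_uniformizer_lt_one : ‖(π : F)‖ < 1 :=
  (Valued.toNormedField.norm_lt_one_iff).mpr hπ.val_lt_one

/-- **The Lubin–Tate character is continuous** as an `F`-valued function: it is `≡ 1` modulo
`π^{n+1}` on the open subgroup `ker (ltAbsChar hπ n)`, and `‖π‖^{n+1} → 0`.
[cite: CasselsFrohlichANT1967, Ch. VI §3.4 Thm. 3 (b)] -/
theorem continuous_coe_lubinTateChar :
    Continuous fun σ => (((lubinTateChar hπ σ : 𝒪[F]ˣ) : 𝒪[F]) : F) := by
  let g : Field.absoluteGaloisGroup F →* F :=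
    ((𝒪[F]).subtype.toMonoidHom.comp (Units.coeHom 𝒪[F])).comp (lubinTateCharHom hπ)
  have hg : ∀ σ, g σ = (((lubinTateChar hπ σ : 𝒪[F]ˣ) : 𝒪[F]) : F) := fun σ => rfl
  suffices h : Continuous g from h
  refine continuous_of_continuousAt_one g ?_
  rw [ContinuousAt, map_one, Metric.tendsto_nhds]
  intro ε hε
  obtain ⟨N, hN⟩ := exists_pow_lt_of_lt_one hε (norm_uniformizer_lt_one hπ)
  filter_upwards [(isOpen_ker_ltAbsChar hπ N).mem_nhds (one_mem _)] with σ hσ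
  have hle := norm_le_of_pow_dvd (F := F) (pow_dvd_lubinTateChar_sub_one hπ hσ)
  rw [dist_eq_norm, hg]
  have e : (((lubinTateChar hπ σ : 𝒪[F]ˣ) : 𝒪[F]) : F) - 1 =
      ((((lubinTateChar hπ σ : 𝒪[F]ˣ) : 𝒪[F]) - 1 : 𝒪[F]) : F) := by simp
  rw [e]
  exact hle.trans_lt ((pow_le_pow_of_le_one (norm_nonneg _) (norm_uniformizer_lt_one hπ).le
    (Nat.le_succ N)).trans_lt hN)

/-- Continuity of `σ ↦ χ_π(σ) ∈ 𝒪_F`. [cite: CasselsFrohlichANT1967, Ch. VI §3.4 Thm. 3 (b)] -/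
theorem continuous_val_lubinTateChar :
    Continuous fun σ => ((lubinTateChar hπ σ : 𝒪[F]ˣ) : 𝒪[F]) :=
  continuous_induced_rng.mpr (continuous_coe_lubinTateChar hπ)

/-- **The Lubin–Tate character `Γ_F →* 𝒪_Fˣ` is continuous** (units topology).
[cite: CasselsFrohlichANT1967, Ch. VI §3.4 Thm. 3 (b)] -/
theorem continuous_lubinTateCharHom : Continuous (lubinTateCharHom hπ) := by
  refine Units.continuous_iff.mpr ⟨continuous_val_lubinTateChar hπ, ?_⟩
  have h : (fun σ => (((lubinTateCharHom hπ σ)⁻¹ : 𝒪[F]ˣ) : 𝒪[F])) =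
      (fun σ => ((lubinTateChar hπ σ : 𝒪[F]ˣ) : 𝒪[F])) ∘ fun σ => σ⁻¹ := by
    funext σ
    rw [Function.comp_apply, ← map_inv (lubinTateCharHom hπ) σ]
    rfl
  rw [h]
  exact (continuous_val_lubinTateChar hπ).comp continuous_inv

/-- **The Lubin–Tate character `χ_π : Γ_F →ₜ* 𝒪_Fˣ`** as a continuous homomorphism.
[cite: CasselsFrohlichANT1967, Ch. VI §3.4 Thm. 3 (b)] -/
def lubinTateCharacter : Field.absoluteGaloisGroup F →ₜ* 𝒪[F]ˣ where
  toMonoidHom := lubinTateCharHom hπ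
  continuous_toFun := continuous_lubinTateCharHom hπ

/-- Unfolding of `lubinTateCharacter`. [folklore] -/
theorem lubinTateCharacter_apply (σ : Field.absoluteGaloisGroup F) :
    lubinTateCharacter hπ σ = lubinTateChar hπ σ := rfl

end Normed

end Concrete

end Literature.NumberTheory.GaloisRepresentations

end
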